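import Literature.AlgebraicGeometry.Resolution.PerronTransforms
import Mathlib
import HarnessLib

/-!
# `Valuative.LuAlphaPTorsor`, line `pfaff-line-log-final-forms`: flag-adapted re-parametrization — convex sublattices and the top block

Route `ResolutionOfSingularities/Valuative`, crux `Valuative.LuAlphaPTorsor`
(stmt-ResolutionOfSingularities-0641), line `pfaff-line-log-final-forms`, stub
`stub_adaptedUnimodular` (F¹ of the rank `≥ 2` Abhyankar core, reshape v6.3): a `ℤ`-independent
family of values admits a unimodular re-parametrization ADAPTED TO THE FLAG OF CONVEX SUBGROUPS
of its lattice. This file is the first half of the pure ordered-group theory behind it, for an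
abstract linearly ordered abelian group `V` (the value lattice, written additively, with the
order reversed so that values `< 1` are the positive elements):

* the CLASS CALCULUS of the convex subgroup `L = {v : ∀ N, N • |v| < B}` of the elements
  infinitely smaller than a top element `B` (`adUni_exists_low`, `adUni_low_lt`,
  `adUni_top_arch`, `adUni_low_pure`, …): `L` is convex and pure, everything outside `L`
  dominates every multiple of everything inside, and any two elements outside `L` are
  archimedean-comparable;
* `adUni_pure_basis` / `adUni_pure_sublattice_basis` — a PURE subgroup of a free `ℤ`-module of
  finite rank is cut out by the vanishing of some coordinates of a basis (Smith normal form,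
  Mathlib's `Submodule.smithNormalForm`, plus purity);
* `adUni_top_block` — THE TOP BLOCK: Knaf–Kuhlmann 2005, Lemma 4.2 (= de Moraes–Novacoski 2020,
  Thm. 3.3, PROVED in `Literature/…/PerronTransforms.lean` as
  `exists_basis_pos_forall_repr_nonneg`) applied to a complement of `L`, followed by a shift of
  the new top vectors by a large element of `L` ("type-2 rescaling"), produces positive top
  vectors, independent and spanning modulo `L`, in which finitely many given non-negative
  elements are `ℕ`-combinations up to NON-NEGATIVE remainders in `L`.

The gluing with an adapted basis of `L` (induction on the rank) is
`…AdaptedUnimodularLattice.lean`; the matrix form of the stub is `…AdaptedUnimodular.lean`.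
-/

set_option linter.dupNamespace false

namespace Summit.ResolutionOfSingularities.ResolutionOfSingularities.Theorems.PfaffLine

open Literature.AlgebraicGeometry.Resolution Module

section ClassCalculus

variable {V : Type*} [AddCommGroup V] [LinearOrder V] [IsOrderedAddMonoid V]

/-- Every element is bounded in absolute value by a multiple of `∑ |bᵢ|`, `b` a `ℤ`-basis. -/
theorem adUni_exists_bound {ι : Type*} [Fintype ι] (b : Basis ι ℤ V) (v : V) :
    ∃ N : ℕ, |v| ≤ N • ∑ i, |b i| := by
  classical
  set M : ℤ := ∑ i, |b.repr v i| with hM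
  have hM0 : 0 ≤ M := Finset.sum_nonneg fun i _ => abs_nonneg _
  refine ⟨M.toNat, ?_⟩
  have h1 : |v| ≤ ∑ i, |b.repr v i| • |b i| := by
    conv_lhs => rw [← b.sum_repr v]
    refine (Finset.abs_sum_le_sum_abs _ _).trans (Finset.sum_le_sum fun i _ => ?_)
    rw [abs_zsmul]
  refine h1.trans ?_
  have h2 : ∀ i, |b.repr v i| • |b i| ≤ M • |b i| := fun i =>
    zsmul_le_zsmul_left (abs_nonneg _)
      (Finset.single_le_sum (fun j _ => abs_nonneg (b.repr v j)) (Finset.mem_univ i))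
  calc ∑ i, |b.repr v i| • |b i| ≤ ∑ i, M • |b i| := Finset.sum_le_sum fun i _ => h2 i
    _ = M.toNat • ∑ i, |b i| := by
      rw [← Finset.smul_sum, ← natCast_zsmul, Int.toNat_of_nonneg hM0]

/-- The elements infinitely smaller than a positive `B` form a subgroup. -/
theorem adUni_exists_low {B : V} (hB : 0 < B) :
    ∃ L : Submodule ℤ V, ∀ v, v ∈ L ↔ ∀ N : ℕ, N • |v| < B := by
  have key : ∀ a b : V, |a| ≤ |b| → (∀ N : ℕ, N • |b| < B) → ∀ N : ℕ, N • |a + b| < B := by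
    intro a b hab hb N
    calc N • |a + b| ≤ N • (|a| + |b|) := nsmul_le_nsmul_right (abs_add_le a b) N
      _ ≤ N • (|b| + |b|) := nsmul_le_nsmul_right (by gcongr) N
      _ = (2 * N) • |b| := by rw [mul_nsmul', two_nsmul, nsmul_add]
      _ < B := hb (2 * N)
  refine ⟨{ carrier := {v | ∀ N : ℕ, N • |v| < B}
            add_mem' := fun {a b} ha hb => ?_
            zero_mem' := fun N => by simpa using hB
            smul_mem' := fun c v hv N => ?_ }, fun v => Iff.rfl⟩
  · show ∀ N : ℕ, N • |a + b| < B
    rcases le_total |a| |b| with h | h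
    · exact key a b h hb
    · simpa only [add_comm] using key b a h ha
  · show N • |c • v| < B
    rw [abs_zsmul, ← Int.natCast_natAbs, natCast_zsmul, ← mul_nsmul']
    exact hv _

variable {B : V} {L : Submodule ℤ V}

/-- An element outside `L` dominates every element of `L`. -/
theorem adUni_low_lt (hL : ∀ v, v ∈ L ↔ ∀ N : ℕ, N • |v| < B) {v w : V} (hv : v ∉ L)
    (hw : w ∈ L) (N : ℕ) : N • |w| < |v| := by
  rw [hL] at hv hw
  push Not at hv
  obtain ⟨N₀, hN₀⟩ := hv
  by_contra h
  rw [not_lt] at h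
  have h1 : N₀ • |v| ≤ (N₀ * N) • |w| := by
    rw [mul_nsmul']
    exact nsmul_le_nsmul_right h N₀
  exact (lt_irrefl B) ((hN₀.trans h1).trans_lt (hw _))

/-- Outside `L` everything is archimedean-comparable from below. -/
theorem adUni_top_arch (hL : ∀ v, v ∈ L ↔ ∀ N : ℕ, N • |v| < B)
    (hbound : ∀ v, ∃ N : ℕ, |v| ≤ N • B) {v : V} (hv : v ∉ L) (w : V) :
    ∃ N : ℕ, |w| ≤ N • |v| := by
  rw [hL] at hv
  push Not at hv
  obtain ⟨N₀, hN₀⟩ := hv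
  obtain ⟨N₁, hN₁⟩ := hbound w
  refine ⟨N₁ * N₀, hN₁.trans ?_⟩
  rw [mul_nsmul']
  exact nsmul_le_nsmul_right hN₀ N₁

/-- `L` is convex. -/
theorem adUni_low_convex (hL : ∀ v, v ∈ L ↔ ∀ N : ℕ, N • |v| < B) {v w : V} (hw : w ∈ L)
    (h : |v| ≤ |w|) : v ∈ L := by
  rw [hL] at hw ⊢
  exact fun N => (nsmul_le_nsmul_right h N).trans_lt (hw N)

/-- `L` is stable under `| |`.
Deprecated (dedup-03070): any submodule is, by Mathlib's `abs_mem_iff` (the hypothesis `hL` is not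
needed); use `abs_mem_iff.mpr`. -/
@[deprecated abs_mem_iff (since := "2026-08-17")]
theorem adUni_low_abs_mem (hL : ∀ v, v ∈ L ↔ ∀ N : ℕ, N • |v| < B) {v : V} (hv : v ∈ L) :
    |v| ∈ L :=
  adUni_low_convex hL hv (abs_abs v).le

/-- `L` is pure. -/
theorem adUni_low_pure (hL : ∀ v, v ∈ L ↔ ∀ N : ℕ, N • |v| < B) {k : ℤ} (hk : k ≠ 0) {v : V}
    (h : k • v ∈ L) : v ∈ L := by
  refine adUni_low_convex hL h ?_
  rw [abs_zsmul, ← Int.natCast_natAbs, natCast_zsmul]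
  exact le_self_nsmul (abs_nonneg v) (Int.natAbs_ne_zero.mpr hk)

omit [IsOrderedAddMonoid V] in
/-- `B ∉ L`. -/
theorem adUni_not_mem_low (hL : ∀ v, v ∈ L ↔ ∀ N : ℕ, N • |v| < B) : B ∉ L := by
  rw [hL]
  intro h
  have := h 1
  rw [one_nsmul] at this
  exact (le_abs_self B).not_gt this

/-- A top part of a non-negative element is positive. -/
theorem adUni_pos_of_add_nonneg (hL : ∀ v, v ∈ L ↔ ∀ N : ℕ, N • |v| < B) {v w : V}
    (hv : v ∉ L) (hw : w ∈ L) (h : 0 ≤ v + w) : 0 < v := by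
  have h1 := adUni_low_lt hL hv hw 1
  rw [one_nsmul] at h1
  by_contra hneg
  rw [not_lt] at hneg
  rw [abs_of_nonpos hneg] at h1
  have : v + w < 0 := by
    calc v + w ≤ v + |w| := by gcongr; exact le_abs_self w
      _ < v + -v := by gcongr
      _ = 0 := add_neg_cancel v
  exact this.not_ge h

/-- Subtracting a low element from a positive top element keeps it positive. -/
theorem adUni_sub_pos (hL : ∀ v, v ∈ L ↔ ∀ N : ℕ, N • |v| < B) {v w : V} (hv : v ∉ L)
    (hpos : 0 < v) (hw : w ∈ L) : 0 < v - w := by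
  have h1 := adUni_low_lt hL hv hw 1
  rw [one_nsmul, abs_of_pos hpos] at h1
  exact sub_pos.mpr ((le_abs_self w).trans_lt h1)

omit [LinearOrder V] [IsOrderedAddMonoid V] in
/-- Translating a non-member by a member gives a non-member. -/
theorem adUni_sub_not_mem {v w : V} (hv : v ∉ L) (hw : w ∈ L) : v - w ∉ L :=
  fun h => hv (by simpa using L.add_mem h hw)

end ClassCalculus

section Split

variable {V : Type*} [AddCommGroup V]

/-- A pure subgroup of a free `ℤ`-module of finite rank is cut out, in a suitable basis, by the
vanishing of some coordinates (Smith normal form + purity). -/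
theorem adUni_pure_basis {n : ℕ} (b : Basis (Fin n) ℤ V) (L : Submodule ℤ V)
    (hpure : ∀ (k : ℤ), k ≠ 0 → ∀ v : V, k • v ∈ L → v ∈ L) :
    ∃ (r : ℕ) (bM : Basis (Fin n) ℤ V) (f : Fin r ↪ Fin n),
      (∀ v, v ∈ L ↔ ∀ j, j ∉ Set.range f → bM.repr v j = 0) ∧ Module.finrank ℤ L = r := by
  classical
  obtain ⟨r, bM, bN, f, a, hsnf⟩ := Submodule.smithNormalForm b L
  have ha : ∀ i, a i ≠ 0 := by
    intro i hai
    have h := hsnf i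
    rw [hai, zero_smul, Submodule.coe_eq_zero] at h
    exact bN.ne_zero i h
  have hmem : ∀ i, bM (f i) ∈ L := fun i =>
    hpure (a i) (ha i) _ (by rw [← hsnf i]; exact (bN i).2)
  have hspan : L = Submodule.span ℤ (bM '' Set.range f) := by
    apply le_antisymm
    · intro v hv
      have h1 : (⟨v, hv⟩ : L) ∈ Submodule.span ℤ (Set.range bN) := by
        rw [bN.span_eq]; exact Submodule.mem_top
      have h2 := Submodule.mem_map_of_mem (f := L.subtype) h1
      rw [Submodule.map_span] at h2
      refine (Submodule.span_le.mpr ?_) h2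
      rintro _ ⟨_, ⟨i, rfl⟩, rfl⟩
      rw [Submodule.subtype_apply, hsnf i]
      exact Submodule.smul_mem _ _ (Submodule.subset_span ⟨f i, ⟨i, rfl⟩, rfl⟩)
    · rw [Submodule.span_le]
      rintro _ ⟨j, ⟨i, rfl⟩, rfl⟩
      exact hmem i
  refine ⟨r, bM, f, fun v => ?_, ?_⟩
  · rw [hspan, Basis.mem_span_image]
    constructor
    · intro h j hj
      by_contra hne
      exact hj (h (by simpa using hne))
    · intro h j hj
      by_contra hj'
      exact (Finsupp.mem_support_iff.mp (Finset.mem_coe.mp hj)) (h j hj')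
  · rw [Module.finrank_eq_card_basis bN, Fintype.card_fin]

end Split

section TopBlock

variable {V : Type*} [AddCommGroup V] [LinearOrder V] [IsOrderedAddMonoid V]

/-- **The top block.** With `L` the convex subgroup of non-top elements, cut out by coordinates
in the basis `bM`, and `D` finite non-negative: there are positive top vectors `c j`, independent
modulo `L` and spanning modulo `L`, such that every `d ∈ D` is an `ℕ`-combination of the `c j`
plus a NON-NEGATIVE remainder in `L` (Knaf–Kuhlmann's Lemma 4.2 on the top block, then a shift
of the new top vectors by a large low element). -/
theorem adUni_top_block [Module.Finite ℤ V] {B : V} {L : Submodule ℤ V}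
    (hL : ∀ v, v ∈ L ↔ ∀ N : ℕ, N • |v| < B) {n r : ℕ} (bM : Basis (Fin n) ℤ V)
    (f : Fin r ↪ Fin n) (hLf : ∀ v, v ∈ L ↔ ∀ j, j ∉ Set.range f → bM.repr v j = 0)
    (D : Finset V) (hD : ∀ d ∈ D, 0 ≤ d) :
    ∃ (m : ℕ) (c : Fin m → V) (E : V → Fin m → ℕ) (res : V → V),
      (∀ j, 0 < c j) ∧
      (∀ μ : Fin m → ℤ, μ ≠ 0 → ∑ j, μ j • c j ∉ L) ∧
      (∀ v, ∃ (μ : Fin m → ℤ) (w : V), w ∈ L ∧ v = ∑ j, μ j • c j + w) ∧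
      (∀ d ∈ D, res d ∈ L ∧ 0 ≤ res d ∧ d = ∑ j, ((E d j : ℕ) : ℤ) • c j + res d) := by
  classical
  -- the top lattice `Λ'`, cut out by the complementary coordinates
  set Λ' : Submodule ℤ V := Submodule.span ℤ (bM '' (Set.range f)ᶜ) with hΛ'
  have hmemΛ' : ∀ v, v ∈ Λ' → ∀ j, j ∈ Set.range f → bM.repr v j = 0 := by
    intro v hv j hj
    rw [hΛ', Basis.mem_span_image] at hv
    by_contra hne
    exact hv (by simpa using hne) hj
  have hinf : ∀ v, v ∈ Λ' → v ∈ L → v = 0 := by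
    intro v h1 h2
    rw [hLf] at h2
    rw [← bM.repr.map_eq_zero_iff]
    ext j
    by_cases hj : j ∈ Set.range f
    · exact hmemΛ' v h1 j hj
    · exact h2 j hj
  have hbMf : ∀ i, bM (f i) ∈ L := fun i => (hLf _).mpr fun j hj => by
    rw [bM.repr_self, Finsupp.single_eq_of_ne]
    rintro rfl
    exact hj ⟨i, rfl⟩
  -- the decomposition `v = top part + low part`
  have hdec : ∀ v, ∃ x w : V, x ∈ Λ' ∧ w ∈ L ∧ v = x + w := by
    intro v
    refine ⟨∑ j ∈ Finset.univ.filter (fun j => j ∉ Set.range f), bM.repr v j • bM j,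
      ∑ j ∈ Finset.univ.filter (fun j => j ∈ Set.range f), bM.repr v j • bM j, ?_, ?_, ?_⟩
    · refine Submodule.sum_mem _ fun j hj => Submodule.smul_mem _ _ (Submodule.subset_span ?_)
      exact ⟨j, (Finset.mem_filter.mp hj).2, rfl⟩
    · refine Submodule.sum_mem _ fun j hj => Submodule.smul_mem _ _ ?_
      obtain ⟨i, hi⟩ := (Finset.mem_filter.mp hj).2
      rw [← hi]
      exact hbMf i
    · conv_lhs => rw [← bM.sum_repr v]
      rw [add_comm]
      exact (Finset.sum_filter_add_sum_filter_not _ _ _).symm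
  choose πT πL hπT hπL hsum using hdec
  have hπTnn : ∀ d ∈ D, 0 ≤ πT d := by
    intro d hd
    by_cases h0 : πT d = 0
    · rw [h0]
    · have hnot : πT d ∉ L := fun h => h0 (hinf _ (hπT d) h)
      have h1 : 0 ≤ πT d + πL d := by rw [← hsum d]; exact hD d hd
      exact (adUni_pos_of_add_nonneg hL hnot (hπL d) h1).le
  -- Knaf–Kuhlmann on the top lattice
  set DT : Finset Λ' := D.attach.image (fun d => ⟨πT d.1, hπT d.1⟩) with hDT
  have hDTnn : ∀ y ∈ DT, 0 ≤ y := by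
    intro y hy
    obtain ⟨d, -, rfl⟩ := Finset.mem_image.mp hy
    rw [← Subtype.coe_le_coe]
    exact hπTnn d.1 d.2
  obtain ⟨cB, hcBpos, hcBrepr⟩ := exists_basis_pos_forall_repr_nonneg (Γ := Λ') DT hDTnn
  have hcoe : ∀ μ : Fin (Module.finrank ℤ Λ') → ℤ,
      ((∑ j, μ j • cB j : Λ') : V) = ∑ j, μ j • (cB j : V) := fun μ => by
    push_cast
    rfl
  have hT : ∀ v, πT v = ∑ j, cB.repr ⟨πT v, hπT v⟩ j • (cB j : V) := fun v => by
    rw [← hcoe, cB.sum_repr]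
  -- the low shift
  set dlow : V := ∑ d ∈ D, |πL d| with hdlow
  have hdlowL : dlow ∈ L := Submodule.sum_mem _ fun d _ => abs_mem_iff.mpr (hπL d)
  have hdlow0 : 0 ≤ dlow := Finset.sum_nonneg fun d _ => abs_nonneg _
  have hdlowge : ∀ d ∈ D, |πL d| ≤ dlow := fun d hd =>
    Finset.single_le_sum (fun d' _ => abs_nonneg (πL d')) hd
  have hcBL : ∀ μ : Fin (Module.finrank ℤ Λ') → ℤ, μ ≠ 0 → ∑ j, μ j • (cB j : V) ∉ L := by
    intro μ hμ hmem
    have h2 := hinf _ (by rw [← hcoe]; exact Submodule.coe_mem _) hmem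
    rw [← hcoe, Submodule.coe_eq_zero] at h2
    exact hμ (funext fun j => Fintype.linearIndependent_iff.mp cB.linearIndependent μ h2 j)
  refine ⟨Module.finrank ℤ Λ', fun j => (cB j : V) - dlow,
    fun v j => (cB.repr ⟨πT v, hπT v⟩ j).toNat,
    fun v => πL v + (∑ j, (((cB.repr ⟨πT v, hπT v⟩ j).toNat : ℕ) : ℤ)) • dlow, ?_, ?_, ?_, ?_⟩
  · -- positivity
    intro j
    have hcj : (cB j : V) ∉ L := by
      have := hcBL (Pi.single j 1) (by simp)
      simpa [Pi.single_apply] using this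
    have hcjpos : (0 : V) < cB j := by
      have := hcBpos j
      rwa [← Subtype.coe_lt_coe, Submodule.coe_zero] at this
    exact adUni_sub_pos hL hcj hcjpos hdlowL
  · -- independence modulo `L`
    intro μ hμ
    have : ∑ j, μ j • ((cB j : V) - dlow) = ∑ j, μ j • (cB j : V) - (∑ j, μ j) • dlow := by
      simp only [smul_sub, Finset.sum_sub_distrib, Finset.sum_smul]
    rw [this]
    exact adUni_sub_not_mem (hcBL μ hμ) (Submodule.smul_mem _ _ hdlowL)
  · -- spanning modulo `L`
    intro v
    refine ⟨fun j => cB.repr ⟨πT v, hπT v⟩ j, (∑ j, cB.repr ⟨πT v, hπT v⟩ j) • dlow + πL v,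
      L.add_mem (L.smul_mem _ hdlowL) (hπL v), ?_⟩
    calc v = πT v + πL v := hsum v
      _ = _ := by
        conv_lhs => rw [hT v]
        simp only [smul_sub, Finset.sum_sub_distrib, Finset.sum_smul]
        abel
  · -- the elements of `D`
    intro d hd
    have he0 : ∀ j, 0 ≤ cB.repr ⟨πT d, hπT d⟩ j := fun j =>
      hcBrepr _ (Finset.mem_image.mpr ⟨⟨d, hd⟩, Finset.mem_attach _ _, rfl⟩) j
    have hcast : ∀ j, (((cB.repr ⟨πT d, hπT d⟩ j).toNat : ℕ) : ℤ) = cB.repr ⟨πT d, hπT d⟩ j :=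
      fun j => Int.toNat_of_nonneg (he0 j)
    simp only [hcast]
    refine ⟨L.add_mem (hπL d) (L.smul_mem _ hdlowL), ?_, ?_⟩
    · by_cases hS : ∑ j, cB.repr ⟨πT d, hπT d⟩ j = 0
      · have hall : ∀ j, cB.repr ⟨πT d, hπT d⟩ j = 0 := fun j =>
          (Finset.sum_eq_zero_iff_of_nonneg fun j _ => he0 j).mp hS j (Finset.mem_univ j)
        have hT0 : πT d = 0 := by rw [hT d]; simp [hall]
        rw [hS, zero_smul, add_zero]
        have := hD d hd
        rwa [hsum d, hT0, zero_add] at this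
      · have hS1 : 1 ≤ ∑ j, cB.repr ⟨πT d, hπT d⟩ j := by
          have : 0 ≤ ∑ j, cB.repr ⟨πT d, hπT d⟩ j := Finset.sum_nonneg fun j _ => he0 j
          omega
        calc (0 : V) ≤ πL d + |πL d| := add_abs_nonneg _
          _ ≤ πL d + dlow := by gcongr; exact hdlowge d hd
          _ = πL d + (1 : ℤ) • dlow := by rw [one_smul]
          _ ≤ πL d + (∑ j, cB.repr ⟨πT d, hπT d⟩ j) • dlow :=
            add_le_add_right (zsmul_le_zsmul_left hdlow0 hS1) _
    · calc d = πT d + πL d := hsum d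
        _ = _ := by
          conv_lhs => rw [hT d]
          simp only [smul_sub, Finset.sum_sub_distrib, Finset.sum_smul]
          abel

end TopBlock

section Anchor

/-- **A pure sublattice is a coordinate sublattice** (registered form of `adUni_pure_basis`):
for a pure subgroup `L` of a free `ℤ`-module `V` of rank `n` there are a basis `bM` of `V` and
an embedding `f : Fin r ↪ Fin n` (`r = rank L`) such that `L` is exactly the set of vectors
whose `bM`-coordinates outside the range of `f` vanish. [folklore] -/
theorem adUni_pure_sublattice_basis : ∀ (V : Type) [AddCommGroup V] (n : ℕ) (b : Module.Basis (Fin n) ℤ V) (L : Submodule ℤ V), (∀ (k : ℤ), k ≠ 0 → ∀ v : V, k • v ∈ L → v ∈ L) → ∃ (r : ℕ) (bM : Module.Basis (Fin n) ℤ V) (f : Fin r ↪ Fin n), (∀ v, v ∈ L ↔ ∀ j, j ∉ Set.range f → bM.repr v j = 0) ∧ Module.finrank ℤ L = r :=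
  fun _ _ _ b L hpure => adUni_pure_basis b L hpure

end Anchor

end Summit.ResolutionOfSingularities.ResolutionOfSingularities.Theorems.PfaffLine
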